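import Summits.Ventures.LatticeQCDFlow.Scaling.OneSidedHubRateLaw
import Summits.Ventures.LatticeQCDFlow.Scaling.OfferCeilingLadderAndMaps

/-!
HONEST FRAMING: exact (Metropolis-corrected) sampling algorithms for lattice gauge theory; figures
of merit are autocorrelation/cost numbers at stated couplings and volumes; no continuum-physics
claim.

# FlowHubRateLaw — MAPS CURE THE OVERLAP, NOT THE TUNNELLING: THE TRANSPORTED SECTOR COUNT IS INVISIBLE TO EVERY
# MAP-ASSISTED EXCHANGE, SO `Gap ≤ (1−t)·Σ_k w_k·Q_k(A_k, A_kᶜ)/Σ_k μ_k(A_k)μ_k(A_kᶜ)`; THE RATE LAW OF THE FLOW HUB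
# (lean-2 GEN-22, ours)

Venture-side (OURS).  Cell `lqcd-flow` (pub-lqcd), unit `pub-lqcd-lean-2-g22`, 2026-08-26.  Chapter J, file 16: the
map version of `Scaling/OneSidedHubRateLaw`.  A map-assisted exchange along an edge `(i, l)` with bijection `φ`
replaces `(x_i, x_l)` by `(φ⁻¹ x_l, φ x_i)`.  If the level sectors are TRANSPORTED by the maps — `φ⁻¹ v ∈ A_i ↔ v ∈ A_l`
on every edge — then the transported count `#{k : x_k ∈ A_k}` is invariant under every exchange, exactly as the plain
count is under identity swaps: sector labels (relative to the transported sectors) are minted only by the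
within-replica updates.  Consequences, for ANY swap graph, ANY maps transporting the sectors, ANY allocation `w`:

* §1 `weightedScheme_spectralGap_le_levelSectorCount` — for every `π̃`-reversible exchange move `Q` preserving a
  level-dependent count `#{k : x_k ∈ A_k}`: `Gap(t·Q + (1−t)·Upd_w) ≤ (1−t)·Σ_k w_k·Q_k(A_k,A_kᶜ)/Σ_k μ_k(A_k)μ_k(A_kᶜ)`
  (the level-dependent form of `Scaling/ExchangeSchemeHandoverCeiling.weightedScheme_spectralGap_le_sectorCount`).
* §2 `ptGraphSwap_transportedCount_eq` — the Metropolis graph swap with maps transporting the sectors preserves the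
  transported count.
* §3 `flowScheme_spectralGap_le_transportedTunneling` (any graph, any allocation), `flowSchemeFrozen_spectralGap_le`
  (cold replicas frozen in their transported sectors: `Gap ≤ (1−t)·w_0·Q_0(A_0,A_0ᶜ)/((K+1)v)` — updates spent on
  frozen cold replicas buy nothing for this mode), `flowHotOnlyStar_spectralGap_le_tunneling` (hot-only star:
  `Gap ≤ (1−t)·Q_0(A_0,A_0ᶜ)/((K+1)v)`, no frozen hypothesis needed).
* §4 **`oneSidedFlowStar_rateLaw`** — the hot-only star with maps `φ_k` under TRANSPORTED one-sided domination
  `p·μ_{k+1}(φ_k u) ≤ μ_0(u)`: floor `p·min{t, γ₀(1−t)}/(14K) ≤ Gap`; tunnelling ceiling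
  `Gap ≤ (1−t)·Q_0(A_0,A_0ᶜ)/((K+1)v)` with `γ₀·μ_0(A_0)μ_0(A_0ᶜ) ≤ Q_0(A_0,A_0ᶜ)`; offer ceiling
  `Gap ≤ 2t·(μ_0(u)/μ_{k+1}(φ_k u))/K`.  Perfect maps make `p = 1` and the offer ceiling harmless; the hot replica's
  own crossing rate `Q_0(A,Aᶜ)/(μ_0(A)μ_0(Aᶜ))` (`≥ γ₀`, and `= Θ(γ₀)` when `A` is the hot bottleneck) still caps the
  scheme, with the same `(1−t)/K` prefactor the floor has: the law is `Gap = Θ_p((t ∧ γ₀(1−t))/K)`.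

NOT CLAIMED: maps that do not transport the sectors (then the count is not invariant and flows CAN mint labels —
that is the regime where a flow beats tunnelling, outside this file); anything measured.  Literature grade (cell
rule): ELEMENTARY (test-function ceilings); nothing cited as a fact; no new bib keys.
-/

noncomputable section

open Finset Function
open Literature.Probability.MarkovChains

namespace Summit.Ventures.LatticeQCDFlow.Scaling

section TransportedCount

variable {S : Type*} [Fintype S] [DecidableEq S] {K : ℕ} {μ : Fin (K + 1) → S → ℝ}
  {M : Fin (K + 1) → S → S → ℝ} {w : Fin (K + 1) → ℝ} {t : ℝ}
  {Q : Matrix (Fin (K + 1) → S) (Fin (K + 1) → S) ℝ}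

/-! ## §1 The level-dependent sector count and its ceiling -/

omit [DecidableEq S] in
/-- The level-dependent centred count is an affine function of the level-dependent count:
`Σ_k f_{A_k}^{(μ_k)}(z_k) = Σ_k μ_k(A_k) − #{k : z_k ∈ A_k}`. [ours] -/
theorem sum_bottleneckTestFun_levelSets [DecidableEq S] (hμ1 : ∀ k, ∑ u, μ k u = 1) (A : Fin (K + 1) → Finset S)
    (z : Fin (K + 1) → S) :
    ∑ k, bottleneckTestFun (μ k) (A k) (z k)
      = (∑ k, (1 - ∑ y ∈ (A k)ᶜ, μ k y)) - ∑ k, (if z k ∈ A k then (1 : ℝ) else 0) := by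
  rw [← Finset.sum_sub_distrib]
  refine sum_congr rfl fun k _ => ?_
  rw [bottleneckTestFun_eq (hμ1 k)]
  split_ifs <;> ring

omit [DecidableEq S] in
/-- All-level transported sector masses: `μ_k(A_k)μ_k(A_kᶜ) ≥ v` for every `k` gives `Σ_k μ_k(A_k)μ_k(A_kᶜ) ≥ (K+1)·v`.
[ours] -/
theorem allLevelSectorMass_ge [DecidableEq S] {A : Fin (K + 1) → Finset S} {v : ℝ}
    (hv : ∀ k : Fin (K + 1), v ≤ (∑ u ∈ A k, μ k u) * ∑ u ∈ (A k)ᶜ, μ k u) :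
    ((K : ℝ) + 1) * v ≤ ∑ k : Fin (K + 1), (∑ u ∈ A k, μ k u) * ∑ u ∈ (A k)ᶜ, μ k u := by
  calc ((K : ℝ) + 1) * v = ∑ _k : Fin (K + 1), v := by
        rw [sum_const, card_univ, Fintype.card_fin, nsmul_eq_mul]; push_cast; ring
    _ ≤ _ := sum_le_sum fun k _ => hv k

/-- **THE LEVEL-DEPENDENT TUNNELLING CEILING:** for `0 ≤ t ≤ 1`, `w` a probability vector, `Q` row-stochastic,
`π̃`-reversible and preserving the level-dependent count `#{k : x_k ∈ A_k}`, `|S| ≥ 2`, `Σ_k μ_k(A_k)μ_k(A_kᶜ) > 0`: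
`Gap(t·Q + (1−t)·Upd_w) ≤ (1−t)·Σ_k w_k·Q_k(A_k,A_kᶜ)/Σ_k μ_k(A_k)μ_k(A_kᶜ)` — the test function
`Σ_k f_{A_k}^{(μ_k)}(x_k)` is invisible to `Q`. [ours] -/
theorem weightedScheme_spectralGap_le_levelSectorCount [Nontrivial S] (hμ : ∀ k x, 0 < μ k x)
    (hμ1 : ∀ k, ∑ u, μ k u = 1) (hM : ∀ k, IsRowStochastic (M k)) (hMrev : ∀ k, DetailedBalance (μ k) (M k))
    (hw0 : ∀ k, 0 ≤ w k) (hw1 : ∑ k, w k = 1) (ht0 : 0 ≤ t) (ht1 : t ≤ 1) (hQ : IsRowStochastic Q)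
    (hQrev : DetailedBalance (tensorFun μ) Q) {A : Fin (K + 1) → Finset S}
    (hQA : ∀ x y, Q x y ≠ 0 → ∑ k, (if y k ∈ A k then (1 : ℝ) else 0) = ∑ k, (if x k ∈ A k then (1 : ℝ) else 0))
    (hA : 0 < ∑ k, (∑ u ∈ A k, μ k u) * ∑ u ∈ (A k)ᶜ, μ k u) :
    spectralGap (tensorFun μ) (fun x y : Fin (K + 1) → S => t * Q x y + (1 - t) * prodKernel w M x y)
      ≤ (1 - t) * (∑ k, w k * edgeMeasure (μ k) (M k) (A k) (A k)ᶜ)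
          / ∑ k, (∑ u ∈ A k, μ k u) * ∑ u ∈ (A k)ᶜ, μ k u := by
  have hP := weightedScheme_isRowStochastic hQ hM hw0 hw1 ht0 ht1
  have hDB := weightedScheme_detailedBalance (w := w) hQrev hMrev t
  have hmean : ∑ x : Fin (K + 1) → S, tensorFun μ x * ∑ k, bottleneckTestFun (μ k) (A k) (x k) = 0 := by
    rw [sum_tensorFun_mul_additive μ hμ1 (fun k => bottleneckTestFun (μ k) (A k))]
    exact Finset.sum_eq_zero fun k _ => sum_mul_bottleneckTestFun (μ k) (A k)
  have hnorm : piInner (tensorFun μ) (fun x => ∑ k, bottleneckTestFun (μ k) (A k) (x k))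
      (fun x => ∑ k, bottleneckTestFun (μ k) (A k) (x k)) = ∑ k, (∑ u ∈ A k, μ k u) * ∑ u ∈ (A k)ᶜ, μ k u := by
    rw [piInner_tensorFun_additive μ hμ1 (fun k => bottleneckTestFun (μ k) (A k))
      (fun k => sum_mul_bottleneckTestFun (μ k) (A k))]
    exact sum_congr rfl fun k _ => piInner_bottleneckTestFun (hμ1 k) (A k)
  have hupd : dirichletForm (tensorFun μ) (prodKernel w M) (fun x => ∑ k, bottleneckTestFun (μ k) (A k) (x k))
      = ∑ k, w k * edgeMeasure (μ k) (M k) (A k) (A k)ᶜ := by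
    rw [dirichletForm_prodKernel_additive μ hμ1 w M (fun k => bottleneckTestFun (μ k) (A k))]
    exact sum_congr rfl fun k _ => by
      rw [dirichletForm_bottleneckTestFun (hM k) ((hMrev k).isStationary (hM k).2) (hμ1 k) (A k)]
  -- the transported count is INVISIBLE to `Q`
  have hinv : dirichletForm (tensorFun μ) Q (fun x => ∑ k, bottleneckTestFun (μ k) (A k) (x k))
      = dirichletForm (tensorFun μ) Q (fun _ => (0 : ℝ)) := by
    refine dirichletForm_congr_support _ _ fun x y hxy => ?_
    rw [sum_bottleneckTestFun_levelSets hμ1 A x, sum_bottleneckTestFun_levelSets hμ1 A y, hQA x y hxy]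
    ring
  have hQ0 : dirichletForm (tensorFun μ) Q (fun _ : Fin (K + 1) → S => (0 : ℝ)) = 0 := by simp [dirichletForm]
  have hray := LevinPeres2017_lemma_13_7_rayleigh (tensorFun_pos hμ) (sum_tensorFun_eq_one μ hμ1) hP hDB hmean
  rw [hnorm, weightedScheme_dirichletForm, hinv, hQ0, hupd, mul_zero, zero_add] at hray
  rw [le_div_iff₀ hA]
  exact hray

/-! ## §2 Map swaps transporting the sectors preserve the transported count -/

omit [Fintype S] in
/-- One map-assisted exchange along `(i, l)` through `φ` with `φ⁻¹ v ∈ A_i ↔ v ∈ A_l`: the transported indicator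
vector of `y = swap(x)` is the one of `x` composed with the transposition `(i l)`. [ours] -/
theorem edgeFlowSwap_transportedIndicator [Fintype S] (φ : Equiv.Perm S) {i l : Fin (K + 1)} (hil : i ≠ l)
    {A : Fin (K + 1) → Finset S} (hA : ∀ v, (φ.symm v ∈ A i ↔ v ∈ A l)) (x : Fin (K + 1) → S) (k : Fin (K + 1)) :
    (if edgeFlowSwap φ i l x k ∈ A k then (1 : ℝ) else 0)
      = (if x (Equiv.swap i l k) ∈ A (Equiv.swap i l k) then (1 : ℝ) else 0) := by
  by_cases hki : k = i
  · subst hki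
    rw [edgeFlowSwap_fst φ hil, Equiv.swap_apply_left]
    by_cases hx : x l ∈ A l
    · rw [if_pos ((hA _).mpr hx), if_pos hx]
    · rw [if_neg (fun h => hx ((hA _).mp h)), if_neg hx]
  · by_cases hkl : k = l
    · subst hkl
      have hiff : φ (x i) ∈ A k ↔ x i ∈ A i := by rw [← hA (φ (x i)), Equiv.symm_apply_apply]
      rw [edgeFlowSwap_snd, Equiv.swap_apply_right]
      by_cases hx : x i ∈ A i
      · rw [if_pos (hiff.mpr hx), if_pos hx]
      · rw [if_neg (fun h => hx (hiff.mp h)), if_neg hx]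
    · rw [edgeFlowSwap_of_ne φ i l x hki hkl, Equiv.swap_apply_of_ne_of_ne hki hkl]

/-- **THE METROPOLIS GRAPH SWAP WITH SECTOR-TRANSPORTING MAPS PRESERVES THE TRANSPORTED COUNT:** edges with distinct
endpoints, maps with `φ_r⁻¹ v ∈ A_{i_r} ↔ v ∈ A_{l_r}` on every edge `e_r = (i_r, l_r)`:
`GSw(x,y) ≠ 0 ⇒ #{k : y_k ∈ A_k} = #{k : x_k ∈ A_k}`. [ours] -/
theorem ptGraphSwap_transportedCount_eq {m : ℕ} {e : Fin m → Fin (K + 1) × Fin (K + 1)} (he : ∀ r, (e r).1 ≠ (e r).2)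
    {φ : Fin m → Equiv.Perm S} (hμ : ∀ k x, 0 < μ k x) {A : Fin (K + 1) → Finset S}
    (hA : ∀ r v, ((φ r).symm v ∈ A (e r).1 ↔ v ∈ A (e r).2)) (x y : Fin (K + 1) → S)
    (hxy : ptGraphSwap μ e φ x y ≠ 0) :
    ∑ k, (if y k ∈ A k then (1 : ℝ) else 0) = ∑ k, (if x k ∈ A k then (1 : ℝ) else 0) := by
  rcases ptGraphSwap_ne_zero he hμ hxy with h | ⟨r, hr⟩
  · rw [h]
  · rw [hr]
    calc ∑ k, (if edgeFlowSwap (φ r) (e r).1 (e r).2 x k ∈ A k then (1 : ℝ) else 0)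
        = ∑ k, (fun j => if x j ∈ A j then (1 : ℝ) else 0) (Equiv.swap (e r).1 (e r).2 k) :=
          sum_congr rfl fun k _ => edgeFlowSwap_transportedIndicator (φ r) (he r) (hA r) x k
      _ = ∑ k, (if x k ∈ A k then (1 : ℝ) else 0) :=
          Equiv.sum_comp (Equiv.swap (e r).1 (e r).2) (fun j => if x j ∈ A j then (1 : ℝ) else 0)

/-! ## §3 The transported tunnelling ceilings -/

/-- **THE TRANSPORTED TUNNELLING CEILING OF ANY MAP-ASSISTED EXCHANGE SCHEME:** any swap graph with distinct endpoints,
maps transporting the level sectors along every edge, any allocation `w`, `0 ≤ t ≤ 1`, `|S| ≥ 2`,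
`Σ_k μ_k(A_k)μ_k(A_kᶜ) > 0`: `Gap ≤ (1−t)·Σ_k w_k·Q_k(A_k,A_kᶜ)/Σ_k μ_k(A_k)μ_k(A_kᶜ)`. [ours] -/
theorem flowScheme_spectralGap_le_transportedTunneling [Nontrivial S] {m : ℕ} {e : Fin m → Fin (K + 1) × Fin (K + 1)}
    (he : ∀ r, (e r).1 ≠ (e r).2) {φ : Fin m → Equiv.Perm S} (hμ : ∀ k x, 0 < μ k x) (hμ1 : ∀ k, ∑ u, μ k u = 1)
    (hM : ∀ k, IsRowStochastic (M k)) (hMrev : ∀ k, DetailedBalance (μ k) (M k)) (hw0 : ∀ k, 0 ≤ w k)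
    (hw1 : ∑ k, w k = 1) (ht0 : 0 ≤ t) (ht1 : t ≤ 1) {A : Fin (K + 1) → Finset S}
    (hA : ∀ r v, ((φ r).symm v ∈ A (e r).1 ↔ v ∈ A (e r).2))
    (hApos : 0 < ∑ k, (∑ u ∈ A k, μ k u) * ∑ u ∈ (A k)ᶜ, μ k u) :
    spectralGap (tensorFun μ) (fun x y : Fin (K + 1) → S => t * ptGraphSwap μ e φ x y + (1 - t) * prodKernel w M x y)
      ≤ (1 - t) * (∑ k, w k * edgeMeasure (μ k) (M k) (A k) (A k)ᶜ)
          / ∑ k, (∑ u ∈ A k, μ k u) * ∑ u ∈ (A k)ᶜ, μ k u :=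
  weightedScheme_spectralGap_le_levelSectorCount hμ hμ1 hM hMrev hw0 hw1 ht0 ht1 (ptGraphSwap_isRowStochastic hμ)
    (ptGraphSwap_detailedBalance hμ) (ptGraphSwap_transportedCount_eq he hμ hA) hApos

/-- **COLD REPLICAS FROZEN IN THEIR TRANSPORTED SECTORS:** if in addition `Q_k(A_k, A_kᶜ) = 0` and
`μ_k(A_k)μ_k(A_kᶜ) ≥ v > 0` for every `k`, then for EVERY allocation `w`:
`Gap ≤ (1−t)·w_0·Q_0(A_0,A_0ᶜ)/((K+1)·v)` — only the hot update mints transported sector labels, and updates spent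
on the frozen cold replicas do not enter. [ours] -/
theorem flowSchemeFrozen_spectralGap_le [Nontrivial S] {m : ℕ} {e : Fin m → Fin (K + 1) × Fin (K + 1)}
    (he : ∀ r, (e r).1 ≠ (e r).2) {φ : Fin m → Equiv.Perm S} (hμ : ∀ k x, 0 < μ k x) (hμ1 : ∀ k, ∑ u, μ k u = 1)
    (hM : ∀ k, IsRowStochastic (M k)) (hMrev : ∀ k, DetailedBalance (μ k) (M k)) (hw0 : ∀ k, 0 ≤ w k)
    (hw1 : ∑ k, w k = 1) (ht0 : 0 ≤ t) (ht1 : t ≤ 1) {A : Fin (K + 1) → Finset S}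
    (hA : ∀ r v, ((φ r).symm v ∈ A (e r).1 ↔ v ∈ A (e r).2)) {v : ℝ} (hvpos : 0 < v)
    (hv : ∀ k : Fin (K + 1), v ≤ (∑ u ∈ A k, μ k u) * ∑ u ∈ (A k)ᶜ, μ k u)
    (hfrozen : ∀ k : Fin (K + 1), k ≠ 0 → edgeMeasure (μ k) (M k) (A k) (A k)ᶜ = 0) :
    spectralGap (tensorFun μ) (fun x y : Fin (K + 1) → S => t * ptGraphSwap μ e φ x y + (1 - t) * prodKernel w M x y)
      ≤ (1 - t) * w 0 * edgeMeasure (μ 0) (M 0) (A 0) (A 0)ᶜ / (((K : ℝ) + 1) * v) := by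
  have hVge := allLevelSectorMass_ge (μ := μ) hv
  have hVpos : 0 < ∑ k : Fin (K + 1), (∑ u ∈ A k, μ k u) * ∑ u ∈ (A k)ᶜ, μ k u :=
    lt_of_lt_of_le (mul_pos (by positivity) hvpos) hVge
  have h := flowScheme_spectralGap_le_transportedTunneling (w := w) he hμ hμ1 hM hMrev hw0 hw1 ht0 ht1 hA hVpos
  have hsum : ∑ k : Fin (K + 1), w k * edgeMeasure (μ k) (M k) (A k) (A k)ᶜ
      = w 0 * edgeMeasure (μ 0) (M 0) (A 0) (A 0)ᶜ := by
    rw [Finset.sum_eq_single (0 : Fin (K + 1)) (fun k _ hk => by rw [hfrozen k hk, mul_zero])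
      (fun h => absurd (mem_univ _) h)]
  rw [hsum, ← mul_assoc] at h
  have hnum : 0 ≤ (1 - t) * w 0 * edgeMeasure (μ 0) (M 0) (A 0) (A 0)ᶜ :=
    mul_nonneg (mul_nonneg (by linarith) (hw0 0)) (edgeMeasure_nonneg (fun u => (hμ 0 u).le) (hM 0).1 _ _)
  exact h.trans (div_le_div_of_nonneg_left hnum (by positivity) hVge)

/-- **THE TUNNELLING CEILING OF THE HOT-ONLY FLOW STAR:** hub `0`, maps `φ_k` with `φ_k⁻¹ v ∈ A_0 ↔ v ∈ A_{k+1}`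
(the cold sectors are the transported hot sector), every update on the hot replica, `μ_k(A_k)μ_k(A_kᶜ) ≥ v > 0`:
`Gap ≤ (1−t)·Q_0(A_0,A_0ᶜ)/((K+1)·v)` — no frozen hypothesis is needed, the cold replicas are never updated. [ours] -/
theorem flowHotOnlyStar_spectralGap_le_tunneling [Nontrivial S] (φ : Fin K → Equiv.Perm S) (hμ : ∀ k x, 0 < μ k x)
    (hμ1 : ∀ k, ∑ u, μ k u = 1) (hM : ∀ k, IsRowStochastic (M k)) (hMrev : ∀ k, DetailedBalance (μ k) (M k))
    (ht0 : 0 ≤ t) (ht1 : t ≤ 1) {A : Fin (K + 1) → Finset S}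
    (hA : ∀ (k : Fin K) (v : S), ((φ k).symm v ∈ A 0 ↔ v ∈ A k.succ)) {v : ℝ} (hvpos : 0 < v)
    (hv : ∀ k : Fin (K + 1), v ≤ (∑ u ∈ A k, μ k u) * ∑ u ∈ (A k)ᶜ, μ k u) :
    spectralGap (tensorFun μ) (fun x y : Fin (K + 1) → S =>
        t * ptGraphSwap μ (fun k : Fin K => ((0 : Fin (K + 1)), k.succ)) φ x y
          + (1 - t) * prodKernel (fun k : Fin (K + 1) => if k = 0 then (1 : ℝ) else 0) M x y)
      ≤ (1 - t) * edgeMeasure (μ 0) (M 0) (A 0) (A 0)ᶜ / (((K : ℝ) + 1) * v) := by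
  have he : ∀ r : Fin K, ((fun k : Fin K => ((0 : Fin (K + 1)), k.succ)) r).1
      ≠ ((fun k : Fin K => ((0 : Fin (K + 1)), k.succ)) r).2 := fun k => (Fin.succ_ne_zero k).symm
  have hw0 : ∀ k : Fin (K + 1), 0 ≤ (if k = 0 then (1 : ℝ) else 0) := fun k => by positivity
  have hVge := allLevelSectorMass_ge (μ := μ) hv
  have hVpos : 0 < ∑ k : Fin (K + 1), (∑ u ∈ A k, μ k u) * ∑ u ∈ (A k)ᶜ, μ k u :=
    lt_of_lt_of_le (mul_pos (by positivity) hvpos) hVge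
  have h := flowScheme_spectralGap_le_transportedTunneling (w := fun k : Fin (K + 1) => if k = 0 then (1 : ℝ) else 0)
    he hμ hμ1 hM hMrev hw0 hotOnlyWeight_sum ht0 ht1 hA hVpos
  have hsum : ∑ k : Fin (K + 1), (if k = 0 then (1 : ℝ) else 0) * edgeMeasure (μ k) (M k) (A k) (A k)ᶜ
      = edgeMeasure (μ 0) (M 0) (A 0) (A 0)ᶜ := by
    rw [Finset.sum_eq_single (0 : Fin (K + 1)) (fun k _ hk => by rw [if_neg hk, zero_mul])
      (fun h => absurd (mem_univ _) h), if_pos rfl, one_mul]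
  rw [hsum] at h
  have hnum : 0 ≤ (1 - t) * edgeMeasure (μ 0) (M 0) (A 0) (A 0)ᶜ :=
    mul_nonneg (by linarith) (edgeMeasure_nonneg (fun u => (hμ 0 u).le) (hM 0).1 _ _)
  exact h.trans (div_le_div_of_nonneg_left hnum (by positivity) hVge)

/-! ## §4 The rate law of the flow hub -/

/-- **ONE-SIDED FLOW STAR, LINEAR FLOOR:** hot-only star with maps `φ_k`, transported one-sided domination
`p·μ_{k+1}(φ_k u) ≤ μ_0(u)` (`0 < p ≤ 1`), hot Poincaré constant `γ₀`, `0 < t < 1`, `K ≥ 1`, `|S| ≥ 2`: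
`p·min{t, γ₀(1−t)}/(14K) ≤ Gap` (from `Scaling/OneSidedHubFloor.oneSidedFlowStar_spectralGap_ge`). [ours] -/
theorem oneSidedFlowStar_spectralGap_ge_linear [Nontrivial S] (φ : Fin K → Equiv.Perm S) (hK : 1 ≤ K)
    (hμ : ∀ k x, 0 < μ k x) (hμ1 : ∀ k, ∑ u, μ k u = 1) (hM : ∀ k, IsRowStochastic (M k))
    (hMrev : ∀ k, DetailedBalance (μ k) (M k)) (ht0 : 0 < t) (ht1 : t < 1) {p γ₀ : ℝ} (hp : 0 < p) (hp1 : p ≤ 1)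
    (hγ₀ : 0 < γ₀) (hdom : ∀ (k : Fin K) (u : S), p * μ k.succ (φ k u) ≤ μ 0 u)
    (hgap0 : ∀ h : S → ℝ, γ₀ * lawVariance (μ 0) h ≤ dirichletForm (μ 0) (M 0) h) :
    p * min t (γ₀ * (1 - t)) / (14 * K)
      ≤ spectralGap (tensorFun μ) (fun x y : Fin (K + 1) → S =>
          t * ptGraphSwap μ (fun k : Fin K => ((0 : Fin (K + 1)), k.succ)) φ x y
            + (1 - t) * prodKernel (fun k : Fin (K + 1) => if k = 0 then (1 : ℝ) else 0) M x y) := by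
  have hKpos : (0 : ℝ) < K := Nat.cast_pos.mpr (by omega)
  have hw0 : ∀ k : Fin (K + 1), 0 ≤ (if k = 0 then (1 : ℝ) else 0) := fun k => by positivity
  have h := oneSidedFlowStar_spectralGap_ge (M := M) (w := fun k : Fin (K + 1) => if k = 0 then (1 : ℝ) else 0)
    φ hK hμ hμ1 hM hMrev hw0 hotOnlyWeight_sum (by simp) ht0 ht1 hp hp1 hγ₀ hdom hgap0
  simp only [if_true, mul_one] at h
  refine le_trans ?_ h
  rw [show p * min t (γ₀ * (1 - t)) / (14 * K) = p * (min t (γ₀ * (1 - t)) / (14 * K)) by ring]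
  refine mul_le_mul_of_nonneg_left (le_min ?_ ?_) hp.le
  · calc min t (γ₀ * (1 - t)) / (14 * K) ≤ t / (14 * K) := div_le_div_of_nonneg_right (min_le_left _ _) (by positivity)
      _ ≤ t / (6 * K) := div_le_div_of_nonneg_left ht0.le (by positivity) (by nlinarith)
  · exact div_le_div_of_nonneg_right (min_le_right _ _) (by positivity)

/-- **ONE-SIDED FLOW STAR, OFFER CEILING:** for every cold level `k+1` and every `u` with `μ_{k+1}(φ_k u) ≤ ½`:
`Gap ≤ 2t·(μ_0(u)/μ_{k+1}(φ_k u))/K` (hot-only allocation, `0 ≤ t ≤ 1`; from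
`Scaling/OfferCeilingLadderAndMaps.flowStar_spectralGap_le_config`). [ours] -/
theorem flowHotOnlyStar_spectralGap_le_offer [Nontrivial S] (φ : Fin K → Equiv.Perm S) (hK : 1 ≤ K)
    (hμ : ∀ k x, 0 < μ k x) (hμ1 : ∀ k, ∑ u, μ k u = 1) (hM : ∀ k, IsRowStochastic (M k))
    (hMrev : ∀ k, DetailedBalance (μ k) (M k)) (ht0 : 0 ≤ t) (ht1 : t ≤ 1) (k : Fin K) {u : S}
    (hu : μ k.succ (φ k u) ≤ 1 / 2) :
    spectralGap (tensorFun μ) (fun x y : Fin (K + 1) → S =>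
        t * ptGraphSwap μ (fun k : Fin K => ((0 : Fin (K + 1)), k.succ)) φ x y
          + (1 - t) * prodKernel (fun k : Fin (K + 1) => if k = 0 then (1 : ℝ) else 0) M x y)
      ≤ 2 * t * (μ 0 u / μ k.succ (φ k u)) / K := by
  have hKpos : (0 : ℝ) < K := Nat.cast_pos.mpr (by omega)
  have hw0 : ∀ k : Fin (K + 1), 0 ≤ (if k = 0 then (1 : ℝ) else 0) := fun k => by positivity
  have h := flowStar_spectralGap_le_config (M := M) (w := fun k : Fin (K + 1) => if k = 0 then (1 : ℝ) else 0)
    (t := t) φ hμ hμ1 hM hMrev hw0 hotOnlyWeight_sum ht0 ht1 k u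
  rw [if_neg (Fin.succ_ne_zero k), mul_zero, zero_mul, add_zero] at h
  refine h.trans ?_
  set a := μ k.succ (φ k u) with ha
  have hapos : 0 < a := hμ _ _
  have h1 : 1 / 2 ≤ 1 - a := by linarith
  rw [div_le_div_iff₀ (mul_pos hapos (by linarith)) hKpos]
  calc t * μ 0 u / K * K = t * μ 0 u * 1 := by field_simp
    _ ≤ t * μ 0 u * (2 * (1 - a)) := mul_le_mul_of_nonneg_left (by linarith) (mul_nonneg ht0 (hμ 0 u).le)
    _ = 2 * t * (μ 0 u / a) * (a * (1 - a)) := by field_simp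

/-- **THE RATE LAW OF THE FLOW HUB:** hot-only star with maps `φ_k`, transported one-sided domination
`p·μ_{k+1}(φ_k u) ≤ μ_0(u)` (`0 < p ≤ 1`), hot update `μ_0`-reversible with Poincaré constant `γ₀`, `0 < t < 1`,
`K ≥ 1`, `|S| ≥ 2`, level sets `A_k` with `φ_k⁻¹ v ∈ A_0 ↔ v ∈ A_{k+1}` and `μ_k(A_k)μ_k(A_kᶜ) ≥ v > 0`:
**floor** `p·min{t, γ₀(1−t)}/(14K) ≤ Gap`;
**tunnelling** `Gap ≤ (1−t)·Q_0(A_0,A_0ᶜ)/((K+1)·v)` and `γ₀·μ_0(A_0)μ_0(A_0ᶜ) ≤ Q_0(A_0,A_0ᶜ)`;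
**offer** `Gap ≤ 2t·(μ_0(u)/μ_{k+1}(φ_k u))/K` for every cold level and every `u` with `μ_{k+1}(φ_k u) ≤ ½`.
Maps remove the overlap obstruction (they can make `p = 1` and the offer ratio `1`); they do not remove the hot
replica's own crossing requirement, which enters floor and ceiling with the same `(1−t)/K`. [ours] -/
theorem oneSidedFlowStar_rateLaw [Nontrivial S] (φ : Fin K → Equiv.Perm S) (hK : 1 ≤ K) (hμ : ∀ k x, 0 < μ k x)
    (hμ1 : ∀ k, ∑ u, μ k u = 1) (hM : ∀ k, IsRowStochastic (M k)) (hMrev : ∀ k, DetailedBalance (μ k) (M k))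
    (ht0 : 0 < t) (ht1 : t < 1) {p γ₀ : ℝ} (hp : 0 < p) (hp1 : p ≤ 1) (hγ₀ : 0 < γ₀)
    (hdom : ∀ (k : Fin K) (u : S), p * μ k.succ (φ k u) ≤ μ 0 u)
    (hgap0 : ∀ h : S → ℝ, γ₀ * lawVariance (μ 0) h ≤ dirichletForm (μ 0) (M 0) h) {A : Fin (K + 1) → Finset S}
    (hA : ∀ (k : Fin K) (v : S), ((φ k).symm v ∈ A 0 ↔ v ∈ A k.succ)) {v : ℝ} (hvpos : 0 < v)
    (hv : ∀ k : Fin (K + 1), v ≤ (∑ u ∈ A k, μ k u) * ∑ u ∈ (A k)ᶜ, μ k u) :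
    p * min t (γ₀ * (1 - t)) / (14 * K)
        ≤ spectralGap (tensorFun μ) (fun x y : Fin (K + 1) → S =>
            t * ptGraphSwap μ (fun k : Fin K => ((0 : Fin (K + 1)), k.succ)) φ x y
              + (1 - t) * prodKernel (fun k : Fin (K + 1) => if k = 0 then (1 : ℝ) else 0) M x y)
      ∧ (spectralGap (tensorFun μ) (fun x y : Fin (K + 1) → S =>
            t * ptGraphSwap μ (fun k : Fin K => ((0 : Fin (K + 1)), k.succ)) φ x y
              + (1 - t) * prodKernel (fun k : Fin (K + 1) => if k = 0 then (1 : ℝ) else 0) M x y)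
          ≤ (1 - t) * edgeMeasure (μ 0) (M 0) (A 0) (A 0)ᶜ / (((K : ℝ) + 1) * v)
        ∧ γ₀ * ((∑ u ∈ A 0, μ 0 u) * ∑ u ∈ (A 0)ᶜ, μ 0 u) ≤ edgeMeasure (μ 0) (M 0) (A 0) (A 0)ᶜ)
      ∧ ∀ (k : Fin K) (u : S), μ k.succ (φ k u) ≤ 1 / 2 →
        spectralGap (tensorFun μ) (fun x y : Fin (K + 1) → S =>
            t * ptGraphSwap μ (fun k : Fin K => ((0 : Fin (K + 1)), k.succ)) φ x y
              + (1 - t) * prodKernel (fun k : Fin (K + 1) => if k = 0 then (1 : ℝ) else 0) M x y)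
          ≤ 2 * t * (μ 0 u / μ k.succ (φ k u)) / K :=
  ⟨oneSidedFlowStar_spectralGap_ge_linear φ hK hμ hμ1 hM hMrev ht0 ht1 hp hp1 hγ₀ hdom hgap0,
    ⟨flowHotOnlyStar_spectralGap_le_tunneling φ hμ hμ1 hM hMrev ht0.le ht1.le hA hvpos hv,
      hot_poincare_le_exitFlow (hμ1 0) (hM 0) (hMrev 0) hgap0 (A 0)⟩,
    fun k _ hu => flowHotOnlyStar_spectralGap_le_offer φ hK hμ hμ1 hM hMrev ht0.le ht1.le k hu⟩

end TransportedCount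

end Summit.Ventures.LatticeQCDFlow.Scaling

end
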